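import Summits.QuantumFields.YangMills.Theorems.BalabanUVNodesK2NamedJetsLimit

/-!
# Crux K2⁷ `EndpointGivenBR13SepCoPH` (stmt-QuantumFields-20543), skeleton v7 CORNER EDITION (plan g84; REGISTERED `795c9e8285fed415`, 2026-08-28T07:45Z) — THE SIGN-KEYED SUPPLIER OF STUB 2ᶜᴰ
# `CornerDriftPos` FROM THE NAMED JETS: at a tuple whose record is ANCHORED by a colour datum's scaled numbers `θ.cβ • beta0OfJs F κ`, the body of 2ᶜᴰ «some anchored corner
# sequence drifts with SOME POSITIVE slope» IS EXACTLY «`0 < CauchyRate.lim (beta0OfJs F κ)`» — SUMMABILITY IS FREE (the pinned family's hypothesis-free geometric rate), only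
# the SIGN of one limit is asked; hence gen 0's LINE 2″ letter Anchor-Positiveᴷ ⟹ 2ᶜᴰ's text with NO U3 ∕ rate letter, and v6's registered pair ∕ LINE 1″ project onto 2ᶜᴰ

Cell `ym-nodeO-ideate`, seat `ym-nodeO-d1-w1` (gen 2; 1ᴬ pen of record, LINE 2″ lineage of gen 0's `…K2NamedJetsLimit` §4).  `--kind proof --supports stmt-QuantumFields-20543 --as helper`;
count-neutral.  0 `def`: 2ᶜᴰ's REGISTERED text (`D84-K2V7/K2Skeleton13SepCoPHv7c.lean` :542 `CornerDriftPos`, stub `stub_cornerDriftPos13` :911; window = DEF-1's `K2V6Defs.Window13`) is written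
INLINE, byte for byte — DEF-1's `K2V7Defs` mirror (INTENT-8) supplies the by-name `Iff.rfl`; every other letter BY NAME: DEF-1's `ScaleAnchor` (p593586) ∕ `beta0OfJs` ∕ `StepColourData` (p588621), gen 0's `two_le_L` ∕
`anchorPositiveK_of_stubTexts` ∕ `anchorPositiveK_of_runRemAtOnVariety` (p607079), g1-p3's `Gaps.CapTailPinnedLimitSign.exists_geomRate_pinned`, gan24-p1's
asym1's `RateCertificate.GeomRate.drift`, CRIT-2's `oneLoopDrift_const_mul`.

THE POINT.  2ᶜᴰ (v7c :542): prefix → `∃ (b : ℕ → ℝ) (s A : ℝ), ScaleAnchor D.βfun b ∧ 0 < s ∧ OneLoopDrift s A b` (`D := Node00.datumOfRecord₁₃SepCoPH F 2 θ hP`).  Its OWNER LINE names the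
ym-nodeO D1 desks for «the identification … served as anchor at an on-variety κ» and the β desks for «(D1) sign + summability of the identified form».  FOR THE IDENTIFIED FORM
`b = θ.cβ • beta0OfJs F κ` THE SUMMABILITY HALF IS A THEOREM: §1 `drift_beta0OfJs_at_lim` — for EVERY family and EVERY colour datum `∃ A, OneLoopDrift (CauchyRate.lim (beta0OfJs F κ)) A
(beta0OfJs F κ)` (the geometric rate of the pinned literal, hypothesis-free) and, scaled, `drift_smul_beta0OfJs_at_lim` (`θ.cβ • beta0OfJs F κ` drifts with slope `θ.cβ · lim`); so at a
tuple ANCHORED by `θ.cβ • beta0OfJs F κ` the (D1) desks owe 2ᶜᴰ ONE SIGN `0 < CauchyRate.lim (beta0OfJs F κ)` — no value, no rate.  §2 ★★ `cornerDriftText_of_anchorPositiveK`: gen 0's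
LINE 2″ letter «prefix → ∃ κ, 0 < lim ∧ anchor» ⟹ 2ᶜᴰ's text (no U3: compare PORT-1's U3-keyed corner-sign road p609637, which needs `ScaleShiftRate` for sequences NOT of the identified
form); `cornerDriftText_of_stubTexts` (v6's registered pair 1ᴬ ∧ 2ᴮ″ ⟹ 2ᶜᴰ's text — plan g84 (3) «v6's pair PROJECTS onto 2ᶜᴰ by ∃-intro», kernel-checked) and
`cornerDriftText_of_runRemAtOnVariety` (gen 0's LINE 1″ ⟹ 2ᶜᴰ's text): VALUE ⟹ SIGN ⟹ CORNER.  SPLIT BY LINEAGE with seat d1-w2 gen 2 (bus 07:21:54Z): the slope-uniqueness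
converses («any drift slope IS the limit», «positive drift ⟺ positive limit»), the per-tuple `iff` at anchored tuples and the VALUE-keyed use forms (plan g84's WANTED wording) are THAT
seat's `…K2CornerDriftOfNamedJets`; this file keeps the always-drift and the three sign-side projections only.

HONEST FRAMING.  [folklore] bookkeeping + two lines of real algebra BY NAME; NOTHING of Bałaban's analysis is asserted; whether ANY colour datum anchors a record, and the SIGN of any
limit `CauchyRate.lim (beta0OfJs F κ)`, are record content ∕ uncomputed numbers — NOT claimed (0 coefficients computed or signed); 2ᶜᴰ ∕ 1ᶜᴿ ∕ K2⁷ NOT proved (every ★ carries an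
anchor-and-sign HYPOTHESIS, instance 0∕1); 1ᴬ's verdict «stub-misstated AS DEALT» (gen 0) untouched; skeleton texts untouched (v7 CORNER `795c9e8285fed415` registered; v6's stub names expired, its
texts live on as supplier letters); counts UNMOVED (typed 28∕28 · discharged 5∕27 (A 5∕28)); [Balaban1987RG1] Thm 2 + (0.31) p. 259 (NODE O) is UNPROVED IN PRINT.  Route R4 closes the CONDITIONAL
finite-𝕋⁴ rung `BalabanLadder.UV` only — NOT continuum, NOT ℝ⁴, NOT OS, NOT a mass gap; the Clay YM mass gap is NOT proved by any of this; no summit statement is proved by this seat.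
No `def`, no `instance`, no `notation`, no `axiom`, 0 `sorry`.  Sources (context only): [I] = [Balaban1987RG1] CMP **109** (1987): Thm 2 p. 259, (1.3) p. 260, (1.22) p. 264,
(2.12)–(2.13) p. 268.
-/

noncomputable section

namespace Summit.QuantumFields.YangMills.Theorems.BalabanUVNodesK2CornerDriftOfAnchorSign

open Filter Topology
open Literature.MathematicalPhysics.QuantumFieldTheory.Balaban1983to89
open Literature.MathematicalPhysics.QuantumFieldTheory.Balaban1983to89.T4Continuum (T4Family)
open Literature.MathematicalPhysics.QuantumFieldTheory.Balaban1983to89.Beta.Drift (OneLoopDrift)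
open Literature.MathematicalPhysics.QuantumFieldTheory.Balaban1983to89.Beta.RateCertificate (CauchyRate GeomRate)
open Literature.MathematicalPhysics.QuantumFieldTheory.Balaban1983to89.Beta.AveragingContoursRooted (ctrOff_mem_box)
open Summit.QuantumFields.YangMills.Theorems.BalabanUVNodesK2JsOfRecord (StepColourData beta0OfJs)
open Summit.QuantumFields.YangMills.Theorems.BalabanUVNodesK2NamedJetsRemAt (ScaleAnchor)
open Summit.QuantumFields.YangMills.Theorems.BalabanUVNodesK2NamedJetsRunRemAt (RunRemAt)
open Summit.QuantumFields.YangMills.Theorems.BalabanUVNodesK2V6Defs (Window13 D1AtAnchoredJets RunRemAtSomeJets)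
open Summit.QuantumFields.YangMills.Theorems.EndpointGivenBR13SepCoPH.Negative.RemNamedJets13FalseOfTwoNormalisations (oneLoopDrift_const_mul)
open Summit.QuantumFields.YangMills.Theorems.BalabanUVNodesK2NamedJetsLimit (two_le_L anchorPositiveK_of_stubTexts anchorPositiveK_of_runRemAtOnVariety)
open Summit.QuantumFields.BalabanUV.Gaps.CapTailPinnedLimitSign (exists_geomRate_pinned)

/-! ## §1 Summability is free: the named numbers DRIFT AT THEIR OWN LIMIT, hypothesis-free -/

section Free

variable (F : T4Family) (κ : StepColourData)

/-- **THE NAMED ONE-LOOP NUMBERS DRIFT WITH SLOPE = THEIR LIMIT, HYPOTHESIS-FREE** (every family, every colour datum): `∃ A, OneLoopDrift (CauchyRate.lim (beta0OfJs F κ)) A (beta0OfJs F κ)` —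
g1-p3's geometric rate of the pinned literal (`exists_geomRate_pinned`, from gan24-p1's all-scales rate) summed (`GeomRate.drift`).  The SUMMABILITY half of «(D1) sign + summability of the
identified form» is thereby a theorem; only the slope's SIGN ∕ VALUE is data. [folklore] -/
theorem drift_beta0OfJs_at_lim : ∃ A : ℝ, OneLoopDrift (CauchyRate.lim (beta0OfJs F κ)) A (beta0OfJs F κ) := by
  haveI : NeZero F.L := ⟨by have := F.hL.2; omega⟩
  obtain ⟨c₀, ϑ, hϑ0, hϑ1, hg⟩ := exists_geomRate_pinned (two_le_L F) (ctrOff_mem_box F.hL.2.le) κ.cE κ.cVH κ.cΛ κ.cB κ.Tc 0 1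
  exact ⟨_, hg.drift hϑ0 hϑ1⟩

/-- the scaled numbers `c • beta0OfJs F κ` drift with slope `c · lim` (`oneLoopDrift_const_mul`). [folklore] -/
theorem drift_smul_beta0OfJs_at_lim (c : ℝ) : ∃ A : ℝ, OneLoopDrift (c * CauchyRate.lim (beta0OfJs F κ)) A (fun k => c * beta0OfJs F κ k) := by
  obtain ⟨A, hA⟩ := drift_beta0OfJs_at_lim F κ
  exact ⟨_, oneLoopDrift_const_mul hA c⟩

end Free

/-! ## §2 The sign-keyed supplier: LINE 2″ ∕ v6's pair ∕ LINE 1″ ⟹ 2ᶜᴰ's text -/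

section Corner

/-- **★★ THE SIGN-KEYED SUPPLIER: gen 0's LINE 2″ letter Anchor-Positiveᴷ ⟹ 2ᶜᴰ's TEXT** (REGISTERED v7 `795c9e8285fed415` :542 `CornerDriftPos` INLINE, byte for byte; window by DEF-1's `Window13`):
at every tuple carrying v6∕v7's prefix, SOME colour datum with POSITIVE one-loop limit whose scaled numbers ANCHOR the record ⟹ an anchored corner sequence drifting with positive slope.
NO U3 ∕ `ScaleShiftRate` letter (the pinned family's rate is free, §1); the hypothesis is record content + one sign, NOT claimed.  CONDITIONAL; 2ᶜᴰ NOT proved.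
[cite: Balaban1987RG1, (1.3) p.260, (1.22) p.264 and (2.13) p.268] -/
theorem cornerDriftText_of_anchorPositiveK
    (hA : ∀ (F : T4Family) (θ : Node00.Stage13HParams F 2) (hP : θ.Provisos₁₃SepCoPH F 2), (θ.ZhUnity F 2 ∧ θ.SlotsNondegenerate₁₃ F 2) → θ.Admissible F 2 →
      B16.EndStatementBPrinted (Node00.datumOfRecord₁₃SepCoPH F 2 θ hP).C → Window13 F θ hP →
      ∃ κ : StepColourData, 0 < CauchyRate.lim (beta0OfJs F κ) ∧ ScaleAnchor (Node00.datumOfRecord₁₃SepCoPH F 2 θ hP).βfun (fun k => θ.cβ * beta0OfJs F κ k)) :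
    ∀ (F : T4Family) (θ : Node00.Stage13HParams F 2) (hP : θ.Provisos₁₃SepCoPH F 2), (θ.ZhUnity F 2 ∧ θ.SlotsNondegenerate₁₃ F 2) → θ.Admissible F 2 →
      B16.EndStatementBPrinted (Node00.datumOfRecord₁₃SepCoPH F 2 θ hP).C → Window13 F θ hP →
      ∃ (b : ℕ → ℝ) (s A : ℝ), ScaleAnchor (Node00.datumOfRecord₁₃SepCoPH F 2 θ hP).βfun b ∧ 0 < s ∧ OneLoopDrift s A b := by
  intro F θ hP hU hθ hB hwin
  obtain ⟨κ, hpos, hanch⟩ := hA F θ hP hU hθ hB hwin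
  obtain ⟨A, hd⟩ := drift_smul_beta0OfJs_at_lim F κ θ.cβ
  exact ⟨_, _, A, hanch, mul_pos hθ.toStage9.chart.1 hpos, hd⟩

/-- **v6's REGISTERED PAIR PROJECTS ONTO 2ᶜᴰ's TEXT** (plan g84 (3) «v6's pair … PROJECT onto 2ᶜᴰ by ∃-intro», kernel-checked): 1ᴬ `K2V6Defs.D1AtAnchoredJets` ∧ 2ᴮ″ `K2V6Defs.RunRemAtSomeJets`
⟹ gen 0's Anchor-Positiveᴷ (`anchorPositiveK_of_stubTexts`: the run letter's anchor conjunct + `lim = stepBal 2 F.L > 0`) ⟹ 2ᶜᴰ's text.  VALUE ⟹ SIGN ⟹ CORNER.  CONDITIONAL. [folklore] -/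
theorem cornerDriftText_of_stubTexts (h₁ : D1AtAnchoredJets) (h₂ : RunRemAtSomeJets) :
    ∀ (F : T4Family) (θ : Node00.Stage13HParams F 2) (hP : θ.Provisos₁₃SepCoPH F 2), (θ.ZhUnity F 2 ∧ θ.SlotsNondegenerate₁₃ F 2) → θ.Admissible F 2 →
      B16.EndStatementBPrinted (Node00.datumOfRecord₁₃SepCoPH F 2 θ hP).C → Window13 F θ hP →
      ∃ (b : ℕ → ℝ) (s A : ℝ), ScaleAnchor (Node00.datumOfRecord₁₃SepCoPH F 2 θ hP).βfun b ∧ 0 < s ∧ OneLoopDrift s A b :=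
  cornerDriftText_of_anchorPositiveK (anchorPositiveK_of_stubTexts h₁ h₂)

/-- **gen 0's LINE 1″ text PROJECTS ONTO 2ᶜᴰ's TEXT**: «prefix → ∃ κ, CauchyRate.lim (beta0OfJs F κ) = stepBal 2 F.L ∧ RunRemAt F κ θ hP θ.cβ» ⟹ Anchor-Positiveᴷ
(`anchorPositiveK_of_runRemAtOnVariety`) ⟹ 2ᶜᴰ's text.  CONDITIONAL. [folklore] -/
theorem cornerDriftText_of_runRemAtOnVariety
    (h : ∀ (F : T4Family) (θ : Node00.Stage13HParams F 2) (hP : θ.Provisos₁₃SepCoPH F 2), (θ.ZhUnity F 2 ∧ θ.SlotsNondegenerate₁₃ F 2) → θ.Admissible F 2 →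
      B16.EndStatementBPrinted (Node00.datumOfRecord₁₃SepCoPH F 2 θ hP).C → Window13 F θ hP →
      ∃ κ : StepColourData, CauchyRate.lim (beta0OfJs F κ) = B12Normalization.stepBal 2 F.L ∧ RunRemAt F κ θ hP θ.cβ) :
    ∀ (F : T4Family) (θ : Node00.Stage13HParams F 2) (hP : θ.Provisos₁₃SepCoPH F 2), (θ.ZhUnity F 2 ∧ θ.SlotsNondegenerate₁₃ F 2) → θ.Admissible F 2 →
      B16.EndStatementBPrinted (Node00.datumOfRecord₁₃SepCoPH F 2 θ hP).C → Window13 F θ hP →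
      ∃ (b : ℕ → ℝ) (s A : ℝ), ScaleAnchor (Node00.datumOfRecord₁₃SepCoPH F 2 θ hP).βfun b ∧ 0 < s ∧ OneLoopDrift s A b :=
  cornerDriftText_of_anchorPositiveK (anchorPositiveK_of_runRemAtOnVariety h)

end Corner

end Summit.QuantumFields.YangMills.Theorems.BalabanUVNodesK2CornerDriftOfAnchorSign

end
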